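import Summits.CriticalPhenomena.PercolationContinuityZ3.Theorems.Transplant.PlanarSkeletonFrmFromDefs
import Summits.CriticalPhenomena.PercolationContinuityZ3.Theorems.Transplant.SkelFrmFromBChoiceWindow
import Summits.CriticalPhenomena.PercolationContinuityZ3.Theorems.Transplant.SkelFrmBChoiceWindow
import HarnessLib
import Summits.CriticalPhenomena.PercolationContinuityZ3.Theorems.Transplant.SkelFrmBChoiceWindowY2
/-!
# U-WAVE PORT (RULING D-U, lead g21 2026-08-26; WAVE-U-MANIFEST v3.0 row «SkelFrmBChoiceWindowY2» ↦ «SkelFrmFromBChoiceWindowY2») of the tree module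
# `Transplant/SkelFrmBChoiceWindowY2` onto the carrier `PlanarSkeletonFrmFrom` (frames only, cylinders connected from width `ℓ₀` on)

ORIGINAL TITLE: N2 (frames-only node `SamePDropOfSkeletonFrm₁`, OPEN) — (ζ″) ledger: THE SECOND-AXIS ALONG RESIDUAL, RETUNED — `NegB.qxYQ2 := (8·sL).toNat + 20`

builds on p205010 (kernel theorem, internal audit signed; external expert review pending) — nothing in this file uses p205010; NOTHING is claimed about the
OPEN node U `SamePDropOfSkeletonFrmFrom₁` (nor U_s / the end state).  Lane `prim-bschramm`, seat `prim-hp-8 gen 53 (U-wave port pen, family P-hp8; tool of record = p3-g26 port_u.py)`; helper file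
(`--supports stmt-CriticalPhenomena-4575 --as helper`).  PORT RULES r1–r4 of RULING D-U: declaration order and proof texts are those of the original,
byte-identical except (i) the carrier token `PlanarSkeletonFrm ↦ PlanarSkeletonFrmFrom` (binders, `namespace`/`end` lines, qualified names of twinned
declarations), (ii) carrier-FREE declarations of the original (φ-level `Skelφ…` blocks and namespace-only arithmetic residents) are NOT re-declared —
this file imports the original and `export`s the twin-free residents (POLICY T / treatment (m1)); residents whose statement mentions a twinned
constant are copied, (iii) every carrier-binding declaration keeps its explicit binder `(Φ : PlanarSkeletonFrmFrom G)` in its own signature (r2).  Docstrings and citations are the original's.  Manifest row idx 71 (level 11; flags verbatim|DEF-ROW); filed by the hp-8 lineage under RULING M-11 (family P-hp8).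
-/

open scoped Classical

noncomputable section

namespace Summit.CriticalPhenomena.PercolationContinuityZ3.Theorems.Transplant

namespace PlanarSkeletonFrmFrom

namespace NegB

open Literature.Probability.Percolation Literature.Probability.LatticeModels SimpleGraph
open SkelConc (Consts)
open Skelφ (shearUnit kgSL)
open Neg

section Y2

variable (κ : Consts) {V : Type} [DecidableEq V] [Countable V] {G : SimpleGraph V} [G.LocallyFinite] (Φ : PlanarSkeletonFrmFrom G) (t : V) (p : unitInterval)
  (D : Skelφ.StepI.DataNS V) (g f : ℕ)

/-- `sL ≤ ⌊nℓ/U⌋` (`sL = ⌊(nℓ − U + 1)/U⌋`). [folklore] -/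
theorem kgSL_le_natDiv (κ : Consts) {V : Type} [DecidableEq V] [Countable V] {G : SimpleGraph V} [G.LocallyFinite] (Φ : PlanarSkeletonFrmFrom G) (t : V) (p : unitInterval) (D : Skelφ.StepI.DataNS V) (g : ℕ) (f : ℕ) (hN : EqNumL κ Φ t p D g f) :
    kgSL (nL κ Φ t p D g f) (ℓL κ Φ t p D g f) (hL κ Φ t p D g f) ≤
      ((nL κ Φ t p D g f * ℓL κ Φ t p D g f / shearUnit (nL κ Φ t p D g f) (hL κ Φ t p D g f) : ℕ) : ℤ) := by
  obtain ⟨hn1, -⟩ := one_le_of_eqNumL κ Φ t p D g f hN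
  have hU : (0 : ℤ) < (shearUnit (nL κ Φ t p D g f) (hL κ Φ t p D g f) : ℕ) := Skelφ.shearUnit_pos hn1 _
  have hdiv : ((nL κ Φ t p D g f * ℓL κ Φ t p D g f / shearUnit (nL κ Φ t p D g f) (hL κ Φ t p D g f) : ℕ) : ℤ) =
      (nL κ Φ t p D g f : ℤ) * ℓL κ Φ t p D g f / (shearUnit (nL κ Φ t p D g f) (hL κ Φ t p D g f) : ℕ) := by push_cast; rfl
  rw [hdiv]; unfold kgSL
  exact Int.ediv_le_ediv hU (by linarith)

/-- **The retuned second-axis along residual** `qxYQ2 := (8·sL).toNat + 20`. [this work] -/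
def qxYQ2 (κ : Consts) {V : Type} [DecidableEq V] [Countable V] {G : SimpleGraph V} [G.LocallyFinite] (Φ : PlanarSkeletonFrmFrom G) (t : V) (p : unitInterval) (D : Skelφ.StepI.DataNS V) (g : ℕ) (f : ℕ) : ℕ := (8 * kgSL (nL κ Φ t p D g f) (ℓL κ Φ t p D g f) (hL κ Φ t p D g f)).toNat + 20

/-- `kgqY qxYQ2 = P + 8·sL + 20` as an integer (`P = ⌊nℓ/U⌋ + 1`). [folklore] -/
theorem kgqY_qxYQ2 (κ : Consts) {V : Type} [DecidableEq V] [Countable V] {G : SimpleGraph V} [G.LocallyFinite] (Φ : PlanarSkeletonFrmFrom G) (t : V) (p : unitInterval) (D : Skelφ.StepI.DataNS V) (g : ℕ) (f : ℕ) (hN : EqNumL κ Φ t p D g f) :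
    ((kgqY κ Φ t p D g f (qxYQ2 κ Φ t p D g f) : ℕ) : ℤ) =
      ((nL κ Φ t p D g f * ℓL κ Φ t p D g f / shearUnit (nL κ Φ t p D g f) (hL κ Φ t p D g f) : ℕ) : ℤ) + 1 +
        8 * kgSL (nL κ Φ t p D g f) (ℓL κ Φ t p D g f) (hL κ Φ t p D g f) + 20 := by
  have hsL := ML_sub_one_le_kgSL κ Φ t p D g f hN
  have h960 := slack_floor_le_ML κ Φ t p D g
  have hM : (959 : ℤ) ≤ ML κ Φ t p D g := by exact_mod_cast (show 959 ≤ ML κ Φ t p D g by omega)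
  unfold kgqY qxYQ2
  push_cast
  rw [Int.toNat_of_nonneg (by linarith)]
  ring

/-- **`KGResY … qxYQ2 WxYQ`** (`8sL + 20 ≤ 40·sL`, `WxYQ ≤ 40·n_L`). [this work] -/
theorem kgResY_Q2 (κ : Consts) {V : Type} [DecidableEq V] [Countable V] {G : SimpleGraph V} [G.LocallyFinite] (Φ : PlanarSkeletonFrmFrom G) (t : V) (p : unitInterval) (D : Skelφ.StepI.DataNS V) (g : ℕ) (f : ℕ) (hN : EqNumL κ Φ t p D g f) : KGResY κ Φ t p D g f (qxYQ2 κ Φ t p D g f) (WxYQ κ Φ t p D g f) := by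
  refine ⟨?_, (kgResY_Q κ Φ t p D g f hN).hWx⟩
  have hsL := ML_sub_one_le_kgSL κ Φ t p D g f hN
  have h960 := slack_floor_le_ML κ Φ t p D g
  have hM : (959 : ℤ) ≤ ML κ Φ t p D g := by exact_mod_cast (show 959 ≤ ML κ Φ t p D g by omega)
  unfold qxYQ2
  rw [kgSLY_eq_kgSL]
  push_cast
  rw [Int.toNat_of_nonneg (by linarith)]
  linarith

/-- **`hbq`** at the window of record and the retuned residual: `bLS small ≤ kgqY qxYQ2 = P + 8·sL + 20` (`bLS small ≤ 9sL + 20`, `sL ≤ P − 1`). [this work] -/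
theorem hbq_small2 (κ : Consts) {V : Type} [DecidableEq V] [Countable V] {G : SimpleGraph V} [G.LocallyFinite] (Φ : PlanarSkeletonFrmFrom G) (t : V) (p : unitInterval) (D : Skelφ.StepI.DataNS V) (g : ℕ) (f : ℕ) (hN : EqNumL κ Φ t p D g f) :
    bLS κ Φ t p D g f (BSlot.small κ Φ t p D g f) ≤ ((kgqY κ Φ t p D g f (qxYQ2 κ Φ t p D g f) : ℕ) : ℤ) := by
  have h := bLS_le κ Φ t p D g f _ (by norm_num) hN (small_row_across κ Φ t p D g f)
  have hP := kgSL_le_natDiv κ Φ t p D g f hN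
  rw [kgqY_qxYQ2 κ Φ t p D g f hN]
  linarith

end Y2

end NegB

end PlanarSkeletonFrmFrom

end Summit.CriticalPhenomena.PercolationContinuityZ3.Theorems.Transplant

end
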